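import Mathlib
import Summits.Ventures.PercRepro.BinomialLayerNA

/-!
# PercRepro — the binomial layer (N1), part B: the three inequalities (typer-2, gen 6; split gen 7)

The second half of the gen-6 module `BinomialLayerN` (split at the section boundary for the 400-line landing lint; every proof
byte-identical): the sums `T(n, j)`, their recursion and closed forms, the truncated sums `Tp`, `F(p, b)` and `Φ(p, 2)`
live in `BinomialLayerNA`; this file carries **`phiTwo_eq`** and the three inequalities of (N1) — `F(p,3) ≥ Φ`,
`5F(p,4) + 4F(p,2) ≥ 9Φ`, `6F(p,2) + 4F(p,3) + F(p,4) ≥ 10Φ` for all `p ≥ 4` (the `D(ℓ)` lemma inputs of `BinomialLayerD`).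
-/

namespace PercRepro

open Finset

namespace BinomialLayer

/-! ### The three inequalities of (N1) -/

/-- `Φ(p, 2)` in closed form: `(2^{p+2} − 2 − 2(p+2) − (p+2)(p+1)) / ((p+2)(p+1)/2)` for `p ≥ 3`. -/
theorem phiTwo_eq (p : ℕ) (hp : 3 ≤ p) :
    phiTwo p = (2 ^ (p + 2) - 2 - 2 * (p + 2) - (p + 2) * (p + 1)) / ((p + 2) * (p + 1) / 2) := by
  unfold phiTwo
  rw [sum_Ioo_choose p hp, choose_add_two_self, Nat.cast_choose_two]
  push_cast
  ring_nf

/-- `D(p) = p(p+1)(p+2)(p+3)` at `p = m + 4`. -/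
def D (m : ℕ) : ℚ := (m + 4) * (m + 5) * (m + 6) * (m + 7)

/-- `D(m) > 0`. -/
theorem D_pos (m : ℕ) : 0 < D m := by unfold D; positivity

/-- `F(p, 2)·D = 2^p(4p² + 20p + 24) − (p⁴ + 10p³ + 39p² + 70p + 48)`, `p = m + 4`. -/
theorem F_two_mul (m : ℕ) :
    F (m + 4) 2 * D m = 2 ^ (m + 4) * (4 * (m + 4 : ℚ) ^ 2 + 20 * (m + 4) + 24) -
      ((m + 4 : ℚ) ^ 4 + 10 * (m + 4) ^ 3 + 39 * (m + 4) ^ 2 + 70 * (m + 4) + 48) := by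
  have hF := F_two (m + 4) (by omega)
  rw [show m + 4 - 1 = m + 3 by omega] at hF
  have hT1 := Tp_eq (m + 3) 1 (by omega)
  have hT2 := Tp_eq (m + 3) 2 (by omega)
  rw [show m + 3 - 1 = m + 2 by omega, T_one] at hT1
  rw [show m + 3 - 1 = m + 2 by omega, T_two] at hT2
  rw [hF, hT1, hT2]
  unfold g D
  push_cast
  have h1 : (m : ℚ) + 1 ≠ 0 := by positivity
  have h2 : (m : ℚ) + 2 ≠ 0 := by positivity
  have h3 : (m : ℚ) + 3 ≠ 0 := by positivity
  have h4 : (m : ℚ) + 4 ≠ 0 := by positivity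
  have h5 : (m : ℚ) + 5 ≠ 0 := by positivity
  have h6 : (m : ℚ) + 6 ≠ 0 := by positivity
  have h7 : (m : ℚ) + 7 ≠ 0 := by positivity
  ring_nf
  field_simp
  ring

/-- `F(p, 3)·D = 2^p(12p² + 12p − 72) − (p⁴ + 12p³ + 35p² − 12p − 108)`, `p = m + 4`. -/
theorem F_three_mul (m : ℕ) :
    F (m + 4) 3 * D m = 2 ^ (m + 4) * (12 * (m + 4 : ℚ) ^ 2 + 12 * (m + 4) - 72) -
      ((m + 4 : ℚ) ^ 4 + 12 * (m + 4) ^ 3 + 35 * (m + 4) ^ 2 - 12 * (m + 4) - 108) := by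
  have hF := F_three (m + 4) (by omega)
  rw [show m + 4 - 1 = m + 3 by omega] at hF
  have hT2 := Tp_eq (m + 3) 2 (by omega)
  have hT3 := Tp_eq (m + 3) 3 (by omega)
  rw [show m + 3 - 1 = m + 2 by omega, T_two] at hT2
  rw [show m + 3 - 1 = m + 2 by omega, T_three] at hT3
  rw [hF, hT2, hT3]
  unfold g D
  push_cast
  have h1 : (m : ℚ) + 1 ≠ 0 := by positivity
  have h2 : (m : ℚ) + 2 ≠ 0 := by positivity
  have h3 : (m : ℚ) + 3 ≠ 0 := by positivity
  have h4 : (m : ℚ) + 4 ≠ 0 := by positivity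
  have h5 : (m : ℚ) + 5 ≠ 0 := by positivity
  have h6 : (m : ℚ) + 6 ≠ 0 := by positivity
  have h7 : (m : ℚ) + 7 ≠ 0 := by positivity
  ring_nf
  field_simp
  ring

/-- `F(p, 4)·D = 2^p(24p² − 72p + 144) − (p⁴ + 18p³ + 47p² + 6p + 144)`, `p = m + 4`. -/
theorem F_four_mul (m : ℕ) :
    F (m + 4) 4 * D m = 2 ^ (m + 4) * (24 * (m + 4 : ℚ) ^ 2 - 72 * (m + 4) + 144) -
      ((m + 4 : ℚ) ^ 4 + 18 * (m + 4) ^ 3 + 47 * (m + 4) ^ 2 + 6 * (m + 4) + 144) := by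
  have hF := F_four (m + 4) (by omega)
  rw [show m + 4 - 1 = m + 3 by omega] at hF
  have hT3 := Tp_eq (m + 3) 3 (by omega)
  have hT4 := Tp_eq (m + 3) 4 (by omega)
  rw [show m + 3 - 1 = m + 2 by omega, T_three] at hT3
  rw [show m + 3 - 1 = m + 2 by omega, T_four] at hT4
  rw [hF, hT3, hT4]
  unfold g D
  push_cast
  have h1 : (m : ℚ) + 1 ≠ 0 := by positivity
  have h2 : (m : ℚ) + 2 ≠ 0 := by positivity
  have h3 : (m : ℚ) + 3 ≠ 0 := by positivity
  have h4 : (m : ℚ) + 4 ≠ 0 := by positivity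
  have h5 : (m : ℚ) + 5 ≠ 0 := by positivity
  have h6 : (m : ℚ) + 6 ≠ 0 := by positivity
  have h7 : (m : ℚ) + 7 ≠ 0 := by positivity
  have h8 : (m : ℚ) + 8 ≠ 0 := by positivity
  ring_nf
  field_simp
  ring

/-- `Φ(p, 2)·D = 2^p(8p² + 24p) − (2p⁴ + 16p³ + 46p² + 48p)`, `p = m + 4`. -/
theorem phiTwo_mul (m : ℕ) :
    phiTwo (m + 4) * D m = 2 ^ (m + 4) * (8 * (m + 4 : ℚ) ^ 2 + 24 * (m + 4)) -
      (2 * (m + 4 : ℚ) ^ 4 + 16 * (m + 4) ^ 3 + 46 * (m + 4) ^ 2 + 48 * (m + 4)) := by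
  rw [phiTwo_eq (m + 4) (by omega)]
  unfold D
  push_cast
  have h5 : (m : ℚ) + 5 ≠ 0 := by positivity
  have h6 : (m : ℚ) + 6 ≠ 0 := by positivity
  ring_nf
  field_simp
  ring

/-- The sign of `2^p·Q + R` from a positive power and a case split. -/
theorem nonneg_of_mul_D {x : ℚ} {m : ℕ} (h : 0 ≤ x * D m) : 0 ≤ x :=
  nonneg_of_mul_nonneg_left h (D_pos m)

/-- **(a)**: `F(p, 3) ≥ Φ(p, 2)` for every `p ≥ 4`. -/
theorem phiTwo_le_F_three (p : ℕ) (hp : 4 ≤ p) : phiTwo p ≤ F p 3 := by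
  obtain ⟨m, rfl⟩ : ∃ m, p = m + 4 := ⟨p - 4, by omega⟩
  have hF := F_three_mul m
  have hΦ := phiTwo_mul m
  have hnum : (0 : ℚ) ≤ 2 ^ (m + 4) * (4 * (m + 4 : ℚ) ^ 2 - 12 * (m + 4) - 72) +
      ((m + 4 : ℚ) ^ 4 + 4 * (m + 4) ^ 3 + 11 * (m + 4) ^ 2 + 60 * (m + 4) + 108) := by
    rcases Nat.lt_or_ge m 2 with hm | hm
    · interval_cases m <;> norm_num
    · have hm' : (2 : ℚ) ≤ m := by exact_mod_cast hm
      have hpow : (0 : ℚ) ≤ 2 ^ (m + 4) := by positivity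
      have hq : (0 : ℚ) ≤ 4 * (m + 4 : ℚ) ^ 2 - 12 * (m + 4) - 72 := by nlinarith
      positivity
  have key : (F (m + 4) 3 - phiTwo (m + 4)) * D m =
      2 ^ (m + 4) * (4 * (m + 4 : ℚ) ^ 2 - 12 * (m + 4) - 72) +
        ((m + 4 : ℚ) ^ 4 + 4 * (m + 4) ^ 3 + 11 * (m + 4) ^ 2 + 60 * (m + 4) + 108) := by
    linear_combination hF - hΦ
  have := nonneg_of_mul_D (key ▸ hnum)
  linarith

/-- **(c)**: `5F(p, 4) + 4F(p, 2) ≥ 9Φ(p, 2)` for every `p ≥ 4`. -/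
theorem nine_phiTwo_le (p : ℕ) (hp : 4 ≤ p) : 9 * phiTwo p ≤ 5 * F p 4 + 4 * F p 2 := by
  obtain ⟨m, rfl⟩ : ∃ m, p = m + 4 := ⟨p - 4, by omega⟩
  have hF2 := F_two_mul m
  have hF4 := F_four_mul m
  have hΦ := phiTwo_mul m
  have hnum : (0 : ℚ) ≤ 2 ^ (m + 4) * (64 * (m + 4 : ℚ) ^ 2 - 496 * (m + 4) + 816) +
      (9 * (m + 4 : ℚ) ^ 4 + 14 * (m + 4) ^ 3 + 23 * (m + 4) ^ 2 + 122 * (m + 4) - 912) := by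
    rcases Nat.lt_or_ge m 2 with hm | hm
    · interval_cases m <;> norm_num
    · have hm' : (2 : ℚ) ≤ m := by exact_mod_cast hm
      have hpow : (0 : ℚ) ≤ 2 ^ (m + 4) := by positivity
      have hq : (0 : ℚ) ≤ 64 * (m + 4 : ℚ) ^ 2 - 496 * (m + 4) + 816 := by nlinarith
      have hq' : (0 : ℚ) ≤ 9 * (m + 4 : ℚ) ^ 4 + 14 * (m + 4) ^ 3 + 23 * (m + 4) ^ 2 +
          122 * (m + 4) - 912 := by nlinarith
      positivity
  have key : (5 * F (m + 4) 4 + 4 * F (m + 4) 2 - 9 * phiTwo (m + 4)) * D m =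
      2 ^ (m + 4) * (64 * (m + 4 : ℚ) ^ 2 - 496 * (m + 4) + 816) +
        (9 * (m + 4 : ℚ) ^ 4 + 14 * (m + 4) ^ 3 + 23 * (m + 4) ^ 2 + 122 * (m + 4) - 912) := by
    linear_combination 5 * hF4 + 4 * hF2 - 9 * hΦ
  have := nonneg_of_mul_D (key ▸ hnum)
  linarith

/-- **(d)**: `6F(p, 2) + 4F(p, 3) + F(p, 4) ≥ 10Φ(p, 2)` for every `p ≥ 4`. -/
theorem ten_phiTwo_le (p : ℕ) (hp : 4 ≤ p) : 10 * phiTwo p ≤ 6 * F p 2 + 4 * F p 3 + F p 4 := by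
  obtain ⟨m, rfl⟩ : ∃ m, p = m + 4 := ⟨p - 4, by omega⟩
  have hF2 := F_two_mul m
  have hF3 := F_three_mul m
  have hF4 := F_four_mul m
  have hΦ := phiTwo_mul m
  have hnum : (0 : ℚ) ≤ 2 ^ (m + 4) * (16 * (m + 4 : ℚ) ^ 2 - 144 * (m + 4)) +
      (9 * (m + 4 : ℚ) ^ 4 + 34 * (m + 4) ^ 3 + 39 * (m + 4) ^ 2 + 102 * (m + 4)) := by
    rcases Nat.lt_or_ge m 5 with hm | hm
    · interval_cases m <;> norm_num
    · have hm' : (5 : ℚ) ≤ m := by exact_mod_cast hm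
      have hpow : (0 : ℚ) ≤ 2 ^ (m + 4) := by positivity
      have hq : (0 : ℚ) ≤ 16 * (m + 4 : ℚ) ^ 2 - 144 * (m + 4) := by nlinarith
      positivity
  have key : (6 * F (m + 4) 2 + 4 * F (m + 4) 3 + F (m + 4) 4 - 10 * phiTwo (m + 4)) * D m =
      2 ^ (m + 4) * (16 * (m + 4 : ℚ) ^ 2 - 144 * (m + 4)) +
        (9 * (m + 4 : ℚ) ^ 4 + 34 * (m + 4) ^ 3 + 39 * (m + 4) ^ 2 + 102 * (m + 4)) := by
    linear_combination 6 * hF2 + 4 * hF3 + hF4 - 10 * hΦ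
  have := nonneg_of_mul_D (key ▸ hnum)
  linarith

end BinomialLayer

end PercRepro
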